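import Summits.QuantumAdvantage.QuantumAdvantage.Theorems.RegisterRotationB

/-! # RegisterRotationC — part 3/4 (mechanical split for landing of `RegisterRotation`; content verbatim; scopes re-opened with their variables) -/

set_option linter.dupNamespace false

namespace Summit.QuantumAdvantage.AdviceFreeQNC0.RegisterRotation
open Classical
open Finset
open Summit.QuantumAdvantage.AdviceFreeQNC0
open Literature.Computability.MetaComplexity Literature.Computability.MetaComplexity.Smolensky
variable {n : ℕ}

section Rotation
open F4

/-- THE ROTATED STRATEGY: re-file every fired cut `g` at its target, XOR on collisions. -/
noncomputable def rot (m : ℕ) (y : Fin (n + 1) → (Fin n → Bool) → Bool) : Fin (n + 1) → (Fin n → Bool) → Bool :=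
  fun h u => decide ((univ.filter fun g : Fin (n + 1) => y g u = true ∧ tgt m u g = h).card % 2 = 1)

/-- **`R_{rot m y}(u) = ω · R_y(u)`** whenever every fired cut of `y` is good at `u`. -/
theorem reg_rot {m : ℕ} (hm : 2 * m ≤ n) (y : Fin (n + 1) → (Fin n → Bool) → Bool) (u : Fin n → Bool)
    (hgood : ∀ g, y g u = true → good m u g = true) : reg (rot m y) u = ω * reg y u := by
  have step1 : reg (rot m y) u =
      ∑ h : Fin (n + 1), ∑ g ∈ (univ.filter fun g : Fin (n + 1) => y g u = true).filter
        (fun g => tgt m u g = h), ω ^ ((tgt m u g).val + walkExp u (tgt m u g).val) := by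
    unfold reg rot
    refine Finset.sum_congr rfl fun h _ => ?_
    rw [iotaF_decide_odd, Finset.card_eq_sum_ones, Nat.cast_sum, Finset.sum_mul, Finset.filter_filter]
    refine Finset.sum_congr rfl fun g hg => ?_
    simp only [mem_filter, mem_univ, true_and] at hg
    rw [hg.2, Nat.cast_one, one_mul]
  have step2 : ∑ h : Fin (n + 1), ∑ g ∈ (univ.filter fun g : Fin (n + 1) => y g u = true).filter
        (fun g => tgt m u g = h), ω ^ ((tgt m u g).val + walkExp u (tgt m u g).val) =
      ∑ g ∈ univ.filter (fun g : Fin (n + 1) => y g u = true),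
        ω ^ ((tgt m u g).val + walkExp u (tgt m u g).val) :=
    Finset.sum_fiberwise_of_maps_to (fun g _ => mem_univ _) _
  rw [step1, step2, reg_eq_sum_filter, Finset.mul_sum]
  refine Finset.sum_congr rfl fun g hg => ?_
  simp only [mem_filter, mem_univ, true_and] at hg
  rw [omega_pow_congr (tgt_spec hm u g (hgood g hg)), pow_succ]
  ring

/-- hence **`WIN_c(rot m y)(u) = WIN_{c+1}(y)(u)`** for every charge, off the bad set. -/
theorem ringWinU_rot {m : ℕ} (hm : 2 * m ≤ n) (c : ℕ) (y : Fin (n + 1) → (Fin n → Bool) → Bool)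
    (u : Fin n → Bool) (hgood : ∀ g, y g u = true → good m u g = true) :
    ringWinU c (rot m y) u = ringWinU (c + 1) y u :=
  ringWinU_of_reg_rotate c (reg_rot hm y u hgood)

/-! ### the bad set: a failed search forces the alternating pattern on the window -/

/-- right search failure ⟹ `u_i = [(i+g) even]` on `[g, g+m)` (walk residues `0,2,0,2,…` relative to `e_g`). -/
theorem pattern_of_missR (u : Fin n → Bool) (g m : ℕ) (hgm : g + m ≤ n) (hmiss : goodR m u g = false) :
    ∀ i : Fin n, g ≤ i.val → i.val < g + m → u i = decide ((i.val + g) % 2 = 0) := by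
  have hmiss' : ∀ j, 1 ≤ j → j ≤ m → (j + onesIn u g (g + j)) % 3 ≠ 1 := by
    intro j h1 h2 h3
    have h := goodR_iff.mpr ⟨j, h1, h2, h3⟩
    rw [hmiss] at h
    exact Bool.false_ne_true h
  -- invariant: walk residue `0` after an even offset, `2` after an odd one; the bits are forced
  have inv : ∀ t, t ≤ m →
      (t % 2 = 0 → (t + onesIn u g (g + t)) % 3 = 0) ∧ (t % 2 = 1 → (t + onesIn u g (g + t)) % 3 = 2) ∧
      ∀ i : Fin n, g ≤ i.val → i.val < g + t → u i = decide ((i.val + g) % 2 = 0) := by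
    intro t
    induction t with
    | zero =>
      intro _
      refine ⟨fun _ => by simp [onesIn_self], fun h => by omega, fun i h1 h2 => by omega⟩
    | succ t ih =>
      intro ht
      obtain ⟨hres0, hres1, hbits⟩ := ih (by omega)
      have hgt : g + t < n := by omega
      have hstep := onesIn_succ_right u (show g ≤ g + t by omega) hgt
      have hm := hmiss' (t + 1) (by omega) ht
      rw [show g + (t + 1) = g + t + 1 by ring, hstep] at hm
      rw [show g + (t + 1) = g + t + 1 by ring, hstep]
      have hbits' : ∀ b : Bool, u ⟨g + t, hgt⟩ = b → (b = decide ((g + t + g) % 2 = 0)) →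
          ∀ i : Fin n, g ≤ i.val → i.val < g + t + 1 → u i = decide ((i.val + g) % 2 = 0) := by
        intro b hb hbv i h1 h2
        by_cases hi : i.val < g + t
        · exact hbits i h1 hi
        · have hieq : i = ⟨g + t, hgt⟩ := Fin.ext (by simp; omega)
          rw [hieq, hb, hbv]
      cases hb : u ⟨g + t, hgt⟩
      · rw [hb] at hm
        simp only [Bool.false_eq_true, if_false, add_zero] at hm ⊢
        have hpar : t % 2 = 1 := by
          by_contra hc
          exact hm (by omega)
        refine ⟨fun h => by omega, fun h => by omega, hbits' false hb ?_⟩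
        symm
        rw [decide_eq_false_iff_not]
        omega
      · rw [hb] at hm
        simp only [if_true] at hm ⊢
        have hpar : t % 2 = 0 := by
          by_contra hc
          exact hm (by omega)
        refine ⟨fun h => by omega, fun h => by omega, hbits' true hb ?_⟩
        symm
        rw [decide_eq_true_eq]
        omega
  intro i h1 h2
  exact (inv m le_rfl).2.2 i h1 h2

/-- left search failure ⟹ `u_i = [(i+g) even]` on `[g−m, g)`. -/
theorem pattern_of_missL (u : Fin n → Bool) (g m : ℕ) (hmg : m ≤ g) (hgn : g ≤ n) (hmiss : goodL m u g = false) :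
    ∀ i : Fin n, g ≤ i.val + m → i.val < g → u i = decide ((i.val + g) % 2 = 0) := by
  have hmiss' : ∀ j, 1 ≤ j → j ≤ m → (j + onesIn u (g - j) g) % 3 ≠ 2 := by
    intro j h1 h2 h3
    have h := goodL_iff.mpr ⟨j, h1, h2, h3⟩
    rw [hmiss] at h
    exact Bool.false_ne_true h
  -- invariant: walk residue `0` after an even offset, `1` after an odd one; the bits are forced
  have inv : ∀ t, t ≤ m →
      (t % 2 = 0 → (t + onesIn u (g - t) g) % 3 = 0) ∧ (t % 2 = 1 → (t + onesIn u (g - t) g) % 3 = 1) ∧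
      ∀ i : Fin n, g ≤ i.val + t → i.val < g → u i = decide ((i.val + g) % 2 = 0) := by
    intro t
    induction t with
    | zero =>
      intro _
      refine ⟨fun _ => by simp [onesIn_self], fun h => by omega, fun i h1 h2 => by omega⟩
    | succ t ih =>
      intro ht
      obtain ⟨hres0, hres1, hbits⟩ := ih (by omega)
      have hgt : g - t - 1 < n := by omega
      have hstep := onesIn_pred_left u (show g - t - 1 + 1 ≤ g by omega) hgt
      rw [show g - t - 1 + 1 = g - t by omega] at hstep
      have hm := hmiss' (t + 1) (by omega) ht
      rw [show g - (t + 1) = g - t - 1 by omega, hstep] at hm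
      rw [show g - (t + 1) = g - t - 1 by omega, hstep]
      have hbits' : ∀ b : Bool, u ⟨g - t - 1, hgt⟩ = b → (b = decide ((g - t - 1 + g) % 2 = 0)) →
          ∀ i : Fin n, g ≤ i.val + (t + 1) → i.val < g → u i = decide ((i.val + g) % 2 = 0) := by
        intro b hb hbv i h1 h2
        by_cases hi : g ≤ i.val + t
        · exact hbits i hi h2
        · have hieq : i = ⟨g - t - 1, hgt⟩ := Fin.ext (by simp; omega)
          rw [hieq, hb, hbv]
      cases hb : u ⟨g - t - 1, hgt⟩
      · rw [hb] at hm
        simp only [Bool.false_eq_true, if_false, zero_add] at hm ⊢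
        have hpar : t % 2 = 0 := by
          by_contra hc
          exact hm (by omega)
        refine ⟨fun h => by omega, fun h => by omega, hbits' false hb ?_⟩
        symm
        rw [decide_eq_false_iff_not]
        omega
      · rw [hb] at hm
        simp only [if_true] at hm ⊢
        have hpar : t % 2 = 1 := by
          by_contra hc
          exact hm (by omega)
        refine ⟨fun h => by omega, fun h => by omega, hbits' true hb ?_⟩
        symm
        rw [decide_eq_true_eq]
        omega
  intro i h1 h2
  exact (inv m le_rfl).2.2 i h1 h2

/-- the window `[a, a+m)` of coordinates, `a + m ≤ n`. -/
def window (a m : ℕ) (h : a + m ≤ n) : Finset (Fin n) :=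
  (Finset.Ico a (a + m)).attachFin fun i hi => by
    rw [Finset.mem_Ico] at hi
    omega

/-- the index window `[a, a + m) ∩ [0, n)` has at most `m` elements. -/
theorem card_window (a m : ℕ) (h : a + m ≤ n) : (window a m h).card = m := by
  unfold window
  rw [Finset.card_attachFin, Nat.card_Ico]
  omega

/-- membership in the index window. -/
theorem mem_window {a m : ℕ} {h : a + m ≤ n} {i : Fin n} : i ∈ window a m h ↔ a ≤ i.val ∧ i.val < a + m := by
  unfold window
  rw [Finset.mem_attachFin, Finset.mem_Ico]

/-- at most `2^{n−m}` inputs carry a prescribed pattern on a window of `m` coordinates. -/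
theorem card_pattern_le (a m : ℕ) (h : a + m ≤ n) (pat : Fin n → Bool) :
    (univ.filter fun u : Fin n → Bool => ∀ i : Fin n, a ≤ i.val → i.val < a + m → u i = pat i).card
      ≤ 2 ^ (n - m) := by
  have hc := Comb37J.card_agree (window a m h) pat
  rw [card_window] at hc
  rw [← hc]
  apply Finset.card_le_card
  intro u hu
  simp only [mem_filter, mem_univ, true_and] at hu ⊢
  intro i hi
  rw [mem_window] at hi
  exact hu i hi.1 hi.2

/-- THE BAD SET of window `m`: inputs at which some cut cannot be rotated. -/
noncomputable def bad (m : ℕ) (n : ℕ) : Finset (Fin n → Bool) :=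
  univ.filter fun u : Fin n → Bool => ∃ g : Fin (n + 1), good m u g = false

/-- **`#bad ≤ (n+1)·2^{n−m}`**. -/
theorem card_bad_le {m : ℕ} (hm : 2 * m ≤ n) : (bad m n).card ≤ (n + 1) * 2 ^ (n - m) := by
  have hsub : bad m n ⊆ (univ : Finset (Fin (n + 1))).biUnion
      (fun g => univ.filter fun u : Fin n → Bool => good m u g = false) := by
    intro u hu
    unfold bad at hu
    simp only [mem_filter, mem_univ, true_and] at hu
    obtain ⟨g, hg⟩ := hu
    rw [Finset.mem_biUnion]
    exact ⟨g, mem_univ _, by simp only [mem_filter, mem_univ, true_and]; exact hg⟩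
  refine (Finset.card_le_card hsub).trans ((Finset.card_biUnion_le).trans ?_)
  have hper : ∀ g ∈ (univ : Finset (Fin (n + 1))),
      (univ.filter fun u : Fin n → Bool => good m u g = false).card ≤ 2 ^ (n - m) := by
    intro g _
    have hg' : g.val ≤ n := Nat.lt_succ_iff.mp g.isLt
    by_cases hR : g.val + m ≤ n
    · refine le_trans (Finset.card_le_card ?_) (card_pattern_le g.val m hR (fun i => decide ((i.val + g.val) % 2 = 0)))
      intro u hu
      simp only [mem_filter, mem_univ, true_and] at hu ⊢
      unfold good at hu
      rw [if_pos hR] at hu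
      exact pattern_of_missR u g.val m hR hu
    · have hL : g.val - m + m ≤ n := by omega
      refine le_trans (Finset.card_le_card ?_)
        (card_pattern_le (g.val - m) m hL (fun i => decide ((i.val + g.val) % 2 = 0)))
      intro u hu
      simp only [mem_filter, mem_univ, true_and] at hu ⊢
      unfold good at hu
      rw [if_neg hR] at hu
      intro i h1 h2
      exact pattern_of_missL u g.val m (by omega) hg' hu i (by omega) (by omega)
  calc ∑ g ∈ (univ : Finset (Fin (n + 1))), (univ.filter fun u : Fin n → Bool => good m u g = false).card
      ≤ ∑ _g ∈ (univ : Finset (Fin (n + 1))), 2 ^ (n - m) := Finset.sum_le_sum hper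
    _ = (n + 1) * 2 ^ (n - m) := by simp

/-- off the bad set every cut is good. -/
theorem good_of_not_mem_bad {m : ℕ} {u : Fin n → Bool} (hu : u ∉ bad m n) (g : Fin (n + 1)) :
    good m u g = true := by
  by_contra h
  exact hu (by unfold bad; simp only [mem_filter, mem_univ, true_and]; exact ⟨g, (Bool.not_eq_true _).mp h⟩)

/-! ### the degree of the rotated strategy -/

/-- `rot m y h` is determined by the selections `y_g`, `|g − h| ≤ m`, and the bits `u_i`, `|i − h| < 2m`. -/
theorem rot_local (m : ℕ) (y : Fin (n + 1) → (Fin n → Bool) → Bool) (h : Fin (n + 1)) {z z' : Fin n → Bool}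
    (hsel : ∀ g : Fin (n + 1), g.val ≤ h.val + m → h.val ≤ g.val + m → y g z = y g z')
    (hbit : ∀ i : Fin n, h.val ≤ i.val + 2 * m → i.val < h.val + 2 * m → z i = z' i) :
    rot m y h z = rot m y h z' := by
  have hS : (univ.filter fun g : Fin (n + 1) => y g z = true ∧ tgt m z g = h) =
      univ.filter fun g : Fin (n + 1) => y g z' = true ∧ tgt m z' g = h := by
    apply Finset.filter_congr
    intro g _
    by_cases hg : g.val ≤ h.val + m ∧ h.val ≤ g.val + m
    · rw [hsel g hg.1 hg.2, tgt_local m g (fun i h1 h2 => hbit i (by omega) (by omega))]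
    · have h1 : tgt m z g ≠ h := by
        intro he
        have hn := tgt_near m z g
        rw [he] at hn
        exact hg ⟨by omega, by omega⟩
      have h2 : tgt m z' g ≠ h := by
        intro he
        have hn := tgt_near m z' g
        rw [he] at hn
        exact hg ⟨by omega, by omega⟩
      simp [h1, h2]
  unfold rot
  rw [hS]

/-- **degree of the rotated strategy**: `≤ (6m+1)·d` (for selections of degree `d ≥ 1`). -/
theorem hasDegF_rot {p : ℕ} [Fact p.Prime] {d : ℕ} (hd : 1 ≤ d) (m : ℕ)
    {y : Fin (n + 1) → (Fin n → Bool) → Bool} (hy : ∀ g, HasDegF p (y g) d) (h : Fin (n + 1)) :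
    HasDegF p (rot m y h) ((6 * m + 1) * d) := by
  -- features: selections in the cut window, bits in the bit window
  let cutWin : Finset (Fin (n + 1)) := univ.filter fun g => g.val ≤ h.val + m ∧ h.val ≤ g.val + m
  let bitWin : Finset (Fin n) := univ.filter fun i => h.val ≤ i.val + 2 * m ∧ i.val < h.val + 2 * m
  let A : Finset (Fin (n + 1) ⊕ Fin n) := cutWin.disjSum bitWin
  let feat : (Fin (n + 1) ⊕ Fin n) → (Fin n → Bool) → Bool := Sum.elim (fun g u => y g u) (fun i u => u i)
  have hfeat : ∀ a ∈ A, (fun z => if feat a z = true then (1 : ZMod p) else 0) ∈ lowDeg (ZMod p) n d := by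
    intro a ha
    rcases a with g | i
    · exact hy g
    · exact bitFn_mem_lowDeg i hd
  have hloc : ∀ z z' : Fin n → Bool, (∀ a ∈ A, feat a z = feat a z') → rot m y h z = rot m y h z' := by
    intro z z' hzz'
    apply rot_local m y h
    · intro g h1 h2
      have hmem : (Sum.inl g : Fin (n + 1) ⊕ Fin n) ∈ A := by
        rw [Finset.inl_mem_disjSum]
        simp only [cutWin, mem_filter, mem_univ, true_and]
        exact ⟨h1, h2⟩
      exact hzz' _ hmem
    · intro i h1 h2
      have hmem : (Sum.inr i : Fin (n + 1) ⊕ Fin n) ∈ A := by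
        rw [Finset.inr_mem_disjSum]
        simp only [bitWin, mem_filter, mem_univ, true_and]
        exact ⟨h1, h2⟩
      exact hzz' _ hmem
  have hmain := GapFibre.ind_mem_lowDeg_of_pattern (F := ZMod p) A feat hfeat (rot m y h) hloc
  have hcut : cutWin.card ≤ 2 * m + 1 := by
    have h1 : cutWin.card ≤ (Finset.Icc (h.val - m) (h.val + m)).card := by
      rw [← Finset.card_image_of_injective cutWin Fin.val_injective]
      apply Finset.card_le_card
      intro x hx
      rw [Finset.mem_image] at hx
      obtain ⟨g, hg, rfl⟩ := hx
      simp only [cutWin, mem_filter, mem_univ, true_and] at hg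
      rw [Finset.mem_Icc]
      omega
    have h2 : (Finset.Icc (h.val - m) (h.val + m)).card ≤ 2 * m + 1 := by
      rw [Nat.card_Icc]
      omega
    exact h1.trans h2
  have hbitc : bitWin.card ≤ 4 * m := by
    have h1 : bitWin.card ≤ (Finset.Ico (h.val - 2 * m) (h.val + 2 * m)).card := by
      rw [← Finset.card_image_of_injective bitWin Fin.val_injective]
      apply Finset.card_le_card
      intro x hx
      rw [Finset.mem_image] at hx
      obtain ⟨i, hi, rfl⟩ := hx
      simp only [bitWin, mem_filter, mem_univ, true_and] at hi
      rw [Finset.mem_Ico]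
      omega
    have h2 : (Finset.Ico (h.val - 2 * m) (h.val + 2 * m)).card ≤ 4 * m := by
      rw [Nat.card_Ico]
      omega
    exact h1.trans h2
  have hA : A.card ≤ 6 * m + 1 := by
    have : A.card = cutWin.card + bitWin.card := Finset.card_disjSum _ _
    omega
  unfold HasDegF
  exact lowDeg_mono (Nat.mul_le_mul_right d hA) hmain


end Rotation
end Summit.QuantumAdvantage.AdviceFreeQNC0.RegisterRotation
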